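import Summits.QuantumFields.YangMills.Theses.UnitScaleTilt

/-!
# Route `UnitScaleTilt` — the aside K2 `HistoryTail` (stmt-QuantumFields-18916) IS COVERED BY the live crux K2-L `HistoryTailL`
# (stmt-QuantumFields-19936): `HistoryTailL → HistoryTail` (support file; neither item is proved here)

Cell `ym3-torus` (rung R3), unit `leafhand-qf-unitscaletilt-1-g0` (D-0181(3) leaf census, 2026-08-30).  `HistoryTailL` is the route
owner's ERRATUM v3 of `HistoryTail`: the profile `(b₀, p₀)` is produced ABOVE arbitrary thresholds `(b₁, p₁)` and BEFORE the free top
fraction `1/m`, with `γ₁` depending on `m`.  Specialising the thresholds to `(0, 0)` and reading off `γ₁` at the given `m` yields the aside's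
body `∀ L m, 0 < m → ∃ b₀ p₀ γ₁, … HistoryTailAt F γ b₀ p₀ m` verbatim.  Consequence for the ledger: the aside 18916 closes by this term the
moment 19936 closes; its registered line `Cruxes/HistoryTail/Lines/birth.lean` (v4, stub `stub_perPlaquetteHighRaw`) is not an
independent obligation.  NOT a proof of K2: the large-field content ([Balaban1985UV3] (71) p.273 summed K-uniformly) is untouched.
-/

namespace Summit.QuantumFields.YangMills.Theorems

/-- **`HistoryTailL → HistoryTail`** (aside stmt-QuantumFields-18916 ⇐ live crux stmt-QuantumFields-19936): take the thresholds
`(b₁, p₁) := (0, 0)` in `HistoryTailL`, then the `γ₁` it serves at the given free top fraction `1/m`.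
[cite: King1986, Thm 3.4 (3.12) p.657; Balaban1985UV3, (7) p.257 and (71) p.273] -/
theorem unitScaleTilt_historyTail_of_historyTailL
    (h : Summit.QuantumFields.YangMills.Theses.UnitScaleTilt.HistoryTailL) :
    Summit.QuantumFields.YangMills.Theses.UnitScaleTilt.HistoryTail := by
  intro L m hm
  obtain ⟨b₀, p₀, -, -, hb, hp, hT⟩ := h L 0 0
  obtain ⟨γ₁, hγ₁, hT'⟩ := hT m hm
  exact ⟨b₀, p₀, γ₁, hb, hp, hγ₁, hT'⟩

end Summit.QuantumFields.YangMills.Theorems
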